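import Literature.Analysis.FluidPDE.Seregin2020AxisymmetricTypeII
import Literature.Analysis.FluidPDE.AxisymmetricTypeIOffAxis
import Literature.Analysis.FluidPDE.SereginEpsilonRegularityHolds
import Literature.Analysis.FluidPDE.NSSuitableESSProofs
import Literature.Analysis.FluidPDE.SuitableWeakInBallTools
import Literature.Analysis.FluidPDE.CKNScalingExtras
import Literature.Analysis.FluidPDE.SereginSverakPressureDecayBalls
import Literature.Analysis.FluidPDE.SuitableWeakStability
import HarnessLib

/-!
# Seregin 2020, proof of Theorem 2.1: the singular points of an axisymmetric suitable weak
# solution lie on the axis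

Analysis/FluidPDE proof file (everything proved; no definitions, no named facts) on the way to
the named fact `Literature.Analysis.FluidPDE.Seregin2020_axisymmetricSingularPoint_typeII`
(`Seregin2020AxisymmetricTypeII.lean`; G. Seregin, Anal. Math. Phys. 10 (2020), Paper 46 =
arXiv:2006.04140, Thm. 2.1). In the proof of (2.6) (p. 5 of the arXiv version) the paper records:
"Denote by `S` the set of singular points of `v`. It is well known that `S` has 1D Hausdorff
measure zero, `x' = 0` for any `z = (x, t) ∈ S`, and any spatial derivative of `v` is Hölder
continuous in `𝒞 × ]-1, 0] ∖ S`." This file proves the middle assertion for the axisymmetric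
suitable weak solutions of Theorem 2.1: every point `z₁ = (t₁, x₁)` of `𝒞 × ]-1, 0]` off the
axis (`|x₁'| > 0`) is a regular point, i.e. `v ∈ L_∞(Q(z₁, r))` for some `r > 0`
(`Seregin2020.offAxis_regular`).

The argument is the classical rotation packing of the dissipation (as in the tree's
`axisymmetric_typeI_boundedNearTop_offAxis_of_seregin`, `AxisymmetricTypeIOffAxis.lean`, written
there for classical solutions): the weak gradient `∇v` of an axisymmetric field is rotation
covariant, `∇v(t, R_θ x) = R_θ ∇v(t, x) R_θ⁻¹` a.e. (`HasWeakSpatialGradientOn.conj_linearIsometryEquiv`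
and the a.e. uniqueness of weak gradients), so `|∇v|²` is rotation invariant a.e. and the
`N ≈ |x₁'|/ρ` disjoint rotated copies of `]t₁ - ρ², t₁[ × B(x₁, ρ)` carry the same dissipation;
hence `E(z₁; ρ) ≤ |x₁'|⁻¹ ∫∫_{]t₁-ρ², t₁[ × 𝒞} |∇v|² → 0` as `ρ → 0`, and Seregin's multi-scale
dissipation criterion (Seregin 2014, Ch. 6, Thm. 1.4, `seregin2014_thm14_holds`) applied to the
pair rescaled from `Q(z₁, R)` to `Q(0, 1)` bounds `v` near `z₁`.

## References

* G. Seregin, Anal. Math. Phys. 10 (2020), Paper 46 = arXiv:2006.04140, proof of Thm. 2.1 (p. 5).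
  [Seregin2020]
* L. Caffarelli, R. Kohn, L. Nirenberg, CPAM 35 (1982), Prop. 2. [CaffarelliKohnNirenberg1982]
* G. Seregin, *Lecture Notes on Regularity Theory for the Navier–Stokes Equations* (2014), Ch. 6,
  Thm. 1.4. [Seregin2014]
* G. Seregin, V. Šverák, Comm. PDE 34 (2009) = arXiv:0804.1803, §3 p. 9 ("all singular points
  must belong to the axis of symmetry"). [SereginSverak2009]
-/

noncomputable section

open MeasureTheory Set Function Filter Topology TopologicalSpace Metric Module
open scoped NNReal ENNReal InnerProductSpace RealInnerProductSpace

namespace Literature.Analysis.FluidPDE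

/-! ### Weak spatial gradients of equivariant fields are covariant under linear isometries -/

section Covariance

variable {E : Type*} [NormedAddCommGroup E] [InnerProductSpace ℝ E] [FiniteDimensional ℝ E]
  [MeasurableSpace E] [BorelSpace E]

/-- The space–time map `(t, x) ↦ (t, R x)` of a linear isometry `R` preserves Lebesgue measure. [folklore] -/
theorem measurePreserving_prodMap_id_linearIsometryEquiv (R : E ≃ₗᵢ[ℝ] E) :
    MeasurePreserving (Prod.map (id : ℝ → ℝ) (R : E → E)) (volume : Measure (ℝ × E)) volume := by
  have h := (MeasurePreserving.id (volume : Measure ℝ)).prod R.measurePreserving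
  rwa [← Measure.volume_eq_prod] at h

omit [FiniteDimensional ℝ E] in
/-- The space–time map `(t, x) ↦ (t, R x)` is a measurable embedding. [folklore] -/
theorem measurableEmbedding_prodMap_id_linearIsometryEquiv (R : E ≃ₗᵢ[ℝ] E) :
    MeasurableEmbedding (Prod.map (id : ℝ → ℝ) (R : E → E)) :=
  MeasurableEmbedding.id.prodMap R.toHomeomorph.measurableEmbedding

omit [FiniteDimensional ℝ E] [MeasurableSpace E] [BorelSpace E] in
/-- **Space–time test functions on an `R`-invariant region compose with `R`.** If `Q` is
invariant under `(t, x) ↦ (t, R x)` and `φ` is a test function on `Q`, so is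
`(t, y) ↦ φ t (R y)`. [folklore] -/
theorem IsSpaceTimeTestOn.comp_linearIsometryEquiv_of_invariant {Q : Opens (ℝ × E)}
    {φ : ℝ → E → ℝ} (hφ : IsSpaceTimeTestOn Q φ) (R : E ≃ₗᵢ[ℝ] E)
    (hQ : ∀ z : ℝ × E, (z.1, R z.2) ∈ Q → z ∈ Q) :
    IsSpaceTimeTestOn Q (fun t y => φ t (R y)) := by
  set Φ : (ℝ × E) ≃L[ℝ] (ℝ × E) :=
    (ContinuousLinearEquiv.refl ℝ ℝ).prodCongr R.toContinuousLinearEquiv with hΦ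
  have heq : uncurry (fun t y => φ t (R y)) = uncurry φ ∘ Φ := by
    funext q; obtain ⟨t, y⟩ := q; rfl
  refine ⟨?_, ?_, ?_⟩
  · rw [heq]; exact hφ.contDiff.comp Φ.contDiff
  · rw [heq]
    exact hφ.hasCompactSupport.comp_homeomorph Φ.toHomeomorph
  · rw [heq, show (uncurry φ ∘ ⇑Φ) = uncurry φ ∘ ⇑Φ.toHomeomorph from rfl, tsupport_comp_eq_preimage]
    intro q hq
    have h1 : Φ.toHomeomorph q ∈ (Q : Set (ℝ × E)) := hφ.tsupport_subset hq
    exact hQ q h1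

/-- **Covariance of weak spatial gradients under a linear isometry.** Let `G` be a weak spatial
gradient of `u` on an open `Q ⊆ ℝ × E` invariant under `(t, x) ↦ (t, R^{±1} x)`, and let `u` be
`R`-equivariant on `Q`, `u(t, R x) = R u(t, x)`. Then `(t, x) ↦ R ∘ G(t, R⁻¹ x) ∘ R⁻¹` is again a
weak spatial gradient of `u` on `Q` (change of variables `x = R y` in the defining identity, the
test function `φ(t, R ·)`, and `⟪R a, w⟫ = ⟪a, R⁻¹ w⟫`). [folklore] -/
theorem HasWeakSpatialGradientOn.conj_linearIsometryEquiv {Q : Opens (ℝ × E)} {u : ℝ → E → E}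
    {G : ℝ → E → E →L[ℝ] E} (h : HasWeakSpatialGradientOn Q u G) (R : E ≃ₗᵢ[ℝ] E)
    (hQ : ∀ z : ℝ × E, (z.1, R z.2) ∈ Q → z ∈ Q) (hQ' : ∀ z : ℝ × E, (z.1, R.symm z.2) ∈ Q → z ∈ Q)
    (hu : ∀ z : ℝ × E, z ∈ Q → u z.1 (R z.2) = R (u z.1 z.2)) :
    HasWeakSpatialGradientOn Q u
      (fun t x => (R : E →L[ℝ] E).comp ((G t (R.symm x)).comp (R.symm : E →L[ℝ] E))) := by
  -- the space–time maps
  set Ψ : ℝ × E → ℝ × E := Prod.map (id : ℝ → ℝ) (R.symm : E → E) with hΨ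
  have hΨmp : MeasurePreserving Ψ (volume : Measure (ℝ × E)) volume :=
    measurePreserving_prodMap_id_linearIsometryEquiv R.symm
  have hΨemb : MeasurableEmbedding Ψ := measurableEmbedding_prodMap_id_linearIsometryEquiv R.symm
  have hΨQ : Ψ ⁻¹' (Q : Set (ℝ × E)) = Q := by
    ext z
    refine ⟨fun hz => hQ' z hz, fun hz => ?_⟩
    show ((z.1, R.symm z.2) : ℝ × E) ∈ (Q : Set (ℝ × E))
    refine hQ (z.1, R.symm z.2) ?_
    show ((z.1, R (R.symm z.2)) : ℝ × E) ∈ Q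
    rw [LinearIsometryEquiv.apply_symm_apply]
    exact hz
  -- the conjugation as a continuous map of `E →L[ℝ] E`
  set conj : (E →L[ℝ] E) → (E →L[ℝ] E) :=
    fun A => (R : E →L[ℝ] E).comp (A.comp (R.symm : E →L[ℝ] E)) with hconj
  have hconj_cont : Continuous conj :=
    ((ContinuousLinearMap.compL ℝ E E E (R : E →L[ℝ] E)).continuous).comp
      ((ContinuousLinearMap.compL ℝ E E E).flip (R.symm : E →L[ℝ] E)).continuous
  have hGeq : uncurry (fun t x => (R : E →L[ℝ] E).comp ((G t (R.symm x)).comp (R.symm : E →L[ℝ] E))) =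
      conj ∘ uncurry G ∘ Ψ := by
    funext z; rfl
  refine ⟨h.locallyIntegrableOn, ?_, fun φ hφ v w => ?_⟩
  · -- local integrability of the conjugated gradient
    rw [hGeq]
    intro z hz
    obtain ⟨U, hU, hGU⟩ := h.locallyIntegrableOn_grad (Ψ z) (by rw [← mem_preimage, hΨQ]; exact hz)
    refine ⟨Ψ ⁻¹' U, ?_, ?_⟩
    · have hc : Continuous Ψ := continuous_id.prodMap R.symm.continuous
      have := hc.continuousWithinAt.preimage_mem_nhdsWithin'' hU rfl
      rwa [hΨQ] at this
    · have h1 : IntegrableOn (uncurry G ∘ Ψ) (Ψ ⁻¹' U) volume := by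
        rw [← hΨemb.integrableOn_map_iff, hΨmp.map_eq]
        exact hGU
      exact ContinuousLinearMap.integrable_comp (ContinuousLinearMap.compL ℝ E E E (R : E →L[ℝ] E)) 
        (ContinuousLinearMap.integrable_comp
          ((ContinuousLinearMap.compL ℝ E E E).flip (R.symm : E →L[ℝ] E)) h1)
  · -- the defining identity
    set φR : ℝ → E → ℝ := fun t y => φ t (R y) with hφR
    have hφR' : IsSpaceTimeTestOn Q φR := hφ.comp_linearIsometryEquiv_of_invariant R hQ
    have key := h.integral_fderiv_mul_inner_eq φR hφR' (R.symm v) (R.symm w)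
    have hRmp : MeasurePreserving (R : E → E) volume volume := R.measurePreserving
    have hRemb : MeasurableEmbedding (R : E → E) := R.toHomeomorph.measurableEmbedding
    -- chain rule for the slices of `φR`
    have hchain : ∀ t y, fderiv ℝ (φR t) y (R.symm v) = fderiv ℝ (φ t) (R y) v := by
      intro t y
      have e : φR t = φ t ∘ (R.toContinuousLinearEquiv : E → E) := rfl
      rw [e, ContinuousLinearEquiv.comp_right_fderiv, ContinuousLinearMap.comp_apply]
      simp
    -- left-hand side: substitute `x = R y`
    have hL : ∀ t, ∫ x, fderiv ℝ (φ t) x v * ⟪u t x, w⟫ =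
        ∫ y, fderiv ℝ (φR t) y (R.symm v) * ⟪u t y, R.symm w⟫ := by
      intro t
      rw [← hRmp.integral_comp hRemb (fun x => fderiv ℝ (φ t) x v * ⟪u t x, w⟫)]
      refine integral_congr_ae (ae_of_all _ fun y => ?_)
      show fderiv ℝ (φ t) (R y) v * ⟪u t (R y), w⟫ = fderiv ℝ (φR t) y (R.symm v) * ⟪u t y, R.symm w⟫
      rw [hchain]
      by_cases hz : ((t, y) : ℝ × E) ∈ Q
      · rw [hu (t, y) hz, LinearIsometryEquiv.inner_map_eq_flip]
      · have hz' : ((t, R y) : ℝ × E) ∉ (Q : Set (ℝ × E)) := fun h' => hz (hQ (t, y) h')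
        rw [hφ.fderiv_slice_eq_zero hz']
        simp
    -- right-hand side: substitute `x = R y`
    have hRt : ∀ t, ∫ x, φ t x * ⟪((R : E →L[ℝ] E).comp ((G t (R.symm x)).comp (R.symm : E →L[ℝ] E))) v, w⟫ =
        ∫ y, φR t y * ⟪G t y (R.symm v), R.symm w⟫ := by
      intro t
      rw [← hRmp.integral_comp hRemb
        (fun x => φ t x * ⟪((R : E →L[ℝ] E).comp ((G t (R.symm x)).comp (R.symm : E →L[ℝ] E))) v, w⟫)]
      refine integral_congr_ae (ae_of_all _ fun y => ?_)
      show φ t (R y) * ⟪((R : E →L[ℝ] E).comp ((G t (R.symm (R y))).comp (R.symm : E →L[ℝ] E))) v, w⟫ =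
        φR t y * ⟪G t y (R.symm v), R.symm w⟫
      simp only [ContinuousLinearMap.comp_apply, LinearIsometryEquiv.coe_coe'',
        LinearIsometryEquiv.symm_apply_apply]
      rw [LinearIsometryEquiv.inner_map_eq_flip]
    simp_rw [hL, hRt]
    exact key

/-- **The dissipation density of an equivariant field is invariant a.e.**: under the hypotheses
of `HasWeakSpatialGradientOn.conj_linearIsometryEquiv`, `|G(t, R x)|² = |G(t, x)|²` for a.e.
`(t, x) ∈ Q` (the conjugated gradient is a weak gradient of `u`, weak gradients are a.e. unique,
and the Frobenius norm is invariant under conjugation by `R`). [folklore] -/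
theorem HasWeakSpatialGradientOn.frobeniusNormSq_comp_ae_eq {Q : Opens (ℝ × E)}
    {u : ℝ → E → E} {G : ℝ → E → E →L[ℝ] E} (h : HasWeakSpatialGradientOn Q u G)
    (R : E ≃ₗᵢ[ℝ] E)
    (hQ : ∀ z : ℝ × E, (z.1, R z.2) ∈ Q → z ∈ Q) (hQ' : ∀ z : ℝ × E, (z.1, R.symm z.2) ∈ Q → z ∈ Q)
    (hu : ∀ z : ℝ × E, z ∈ Q → u z.1 (R z.2) = R (u z.1 z.2)) :
    ∀ᵐ z ∂(volume.restrict (Q : Set (ℝ × E))),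
      frobeniusNormSq (G z.1 (R.symm z.2)) = frobeniusNormSq (G z.1 z.2) := by
  have h' := h.conj_linearIsometryEquiv R hQ hQ' hu
  filter_upwards [h.ae_eq h'] with z hz
  have hz' : G z.1 z.2 = (R : E →L[ℝ] E).comp ((G z.1 (R.symm z.2)).comp (R.symm : E →L[ℝ] E)) := hz
  rw [hz', frobeniusNormSq_conj_linearIsometryEquiv]

end Covariance

/-! ### Rotation packing of an a.e. rotation invariant density -/

section Packing

/-- **Rotated cylinders carry the same integral** of a density `F` on `ℝ × EuclideanSpace ℝ (Fin 3)` which is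
invariant a.e. under every rotation about the axis: `∫_{I × B(R_θ x₀, ρ)} F = ∫_{I × B(x₀, ρ)} F`.
[folklore] -/
theorem setLIntegral_prod_ball_rotZ_eq_of_ae {F : ℝ × EuclideanSpace ℝ (Fin 3) → ℝ≥0∞}
    (hF : ∀ θ : ℝ, (fun z : ℝ × EuclideanSpace ℝ (Fin 3) => F (z.1, rotZ θ z.2)) =ᵐ[volume] F) (I : Set ℝ)
    (θ : ℝ) (x₀ : EuclideanSpace ℝ (Fin 3)) (ρ : ℝ) :
    ∫⁻ z in I ×ˢ ball (rotZ θ x₀) ρ, F z = ∫⁻ z in I ×ˢ ball x₀ ρ, F z := by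
  set Ψ : ℝ × EuclideanSpace ℝ (Fin 3) → ℝ × EuclideanSpace ℝ (Fin 3) := Prod.map id (rotZLIE θ) with hΨdef
  have hΨ : ∀ z, Ψ z = (z.1, rotZ θ z.2) := fun z => rfl
  have hmp : MeasurePreserving Ψ (volume : Measure (ℝ × EuclideanSpace ℝ (Fin 3))) volume :=
    measurePreserving_prodMap_id_linearIsometryEquiv (rotZLIE θ)
  have hemb : MeasurableEmbedding Ψ := measurableEmbedding_prodMap_id_linearIsometryEquiv (rotZLIE θ)
  have hpre : Ψ ⁻¹' (I ×ˢ ball (rotZ θ x₀) ρ) = I ×ˢ ball x₀ ρ := by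
    ext ⟨t, x⟩
    simp only [mem_preimage, hΨ, mem_prod, mem_ball]
    rw [← rotZLIE_apply θ x, ← rotZLIE_apply θ x₀, (rotZLIE θ).dist_map]
  rw [← hmp.setLIntegral_comp_preimage_emb hemb _ (I ×ˢ ball (rotZ θ x₀) ρ), hpre]
  refine lintegral_congr_ae (ae_restrict_of_ae ?_)
  filter_upwards [hF θ] with z hz
  rw [hΨ]
  exact hz

/-- **The packing bound** for an a.e. rotation invariant density `F`: for `x₀` off the axis and
`0 < ρ ≤ ρ₀ = |x₀'|`, `∫_{I × B(x₀, ρ)} F ≤ (ρ/ρ₀) ∫_{I × EuclideanSpace ℝ (Fin 3)} F` (the `N = ⌈ρ₀/ρ⌉` rotated copies of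
the cylinder are pairwise disjoint and carry the same integral; verbatim the proof of
`AxisymmetricTypeIHyp.setLIntegral_prod_ball_le_of_axisymmetric`). [folklore] -/
theorem setLIntegral_prod_ball_le_of_rot_invariant {F : ℝ × EuclideanSpace ℝ (Fin 3) → ℝ≥0∞}
    (hF : ∀ θ : ℝ, (fun z : ℝ × EuclideanSpace ℝ (Fin 3) => F (z.1, rotZ θ z.2)) =ᵐ[volume] F) {x₀ : EuclideanSpace ℝ (Fin 3)}
    (hx₀ : 0 < cylRadius x₀) {ρ : ℝ} (hρ : 0 < ρ) (hρle : ρ ≤ cylRadius x₀) {I : Set ℝ}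
    (hI : MeasurableSet I) :
    ∫⁻ z in I ×ˢ ball x₀ ρ, F z ≤
      ENNReal.ofReal (ρ / cylRadius x₀) * ∫⁻ z in I ×ˢ (univ : Set (EuclideanSpace ℝ (Fin 3))), F z := by
  -- the number of balls
  set N : ℕ := ⌈cylRadius x₀ / ρ⌉₊ with hN
  have hq : 1 ≤ cylRadius x₀ / ρ := by rw [le_div_iff₀ hρ, one_mul]; exact hρle
  have hN1 : cylRadius x₀ / ρ ≤ N := Nat.le_ceil _
  have hNpos : (0 : ℝ) < N := lt_of_lt_of_le (by linarith) hN1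
  have hN0 : N ≠ 0 := by exact_mod_cast hNpos.ne'
  -- the angle step
  set δ : ℝ := Real.pi * ρ / cylRadius x₀ with hδ
  have hδ0 : 0 ≤ δ := by positivity
  have hδρ : δ * cylRadius x₀ = Real.pi * ρ := by rw [hδ]; field_simp
  have hδπ : δ ≤ Real.pi := by
    rw [hδ, div_le_iff₀ hx₀]
    nlinarith [Real.pi_pos]
  have hNδ : ((N : ℝ) - 1) * δ ≤ Real.pi := by
    have hN2 : (N : ℝ) < cylRadius x₀ / ρ + 1 := Nat.ceil_lt_add_one (by positivity)
    have h1 : (N : ℝ) - 1 ≤ cylRadius x₀ / ρ := by linarith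
    calc ((N : ℝ) - 1) * δ ≤ cylRadius x₀ / ρ * δ := mul_le_mul_of_nonneg_right h1 hδ0
      _ = Real.pi := by rw [hδ]; field_simp
  have hchord : 4 * ρ ^ 2 ≤ 2 * (1 - Real.cos δ) * cylRadius x₀ ^ 2 := by
    have h1 := two_mul_sq_le_pi_sq_mul_one_sub_cos hδ0 hδπ
    have h3 : Real.pi ^ 2 * (2 * ρ ^ 2) ≤ Real.pi ^ 2 * ((1 - Real.cos δ) * cylRadius x₀ ^ 2) := by
      have e : Real.pi ^ 2 * (2 * ρ ^ 2) = 2 * δ ^ 2 * cylRadius x₀ ^ 2 := by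
        rw [show 2 * δ ^ 2 * cylRadius x₀ ^ 2 = 2 * (δ * cylRadius x₀) ^ 2 by ring, hδρ]
        ring
      rw [e]
      nlinarith [mul_le_mul_of_nonneg_right h1 (sq_nonneg (cylRadius x₀))]
    have h4 := le_of_mul_le_mul_left h3 (by positivity)
    linarith
  -- the centres
  set c : Fin N → EuclideanSpace ℝ (Fin 3) := fun k => rotZ (((k : ℕ) : ℝ) * δ) x₀ with hc
  have hsep : ∀ j k : Fin N, j ≠ k → 2 * ρ ≤ dist (c j) (c k) := by
    intro j k hjk
    rcases lt_or_gt_of_ne (Fin.val_injective.ne hjk) with h | h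
    · exact two_mul_le_dist_rotZ_of_lt hδ0 hNδ hρ.le hchord h k.isLt
    · rw [dist_comm]
      exact two_mul_le_dist_rotZ_of_lt hδ0 hNδ hρ.le hchord h j.isLt
  -- the disjoint rotated cylinders carry `N` times the integral of one of them
  have hsum := sum_setLIntegral_prod_ball_le c hsep hI F (I := I)
  have hterm : ∀ k : Fin N, ∫⁻ z in I ×ˢ ball (c k) ρ, F z = ∫⁻ z in I ×ˢ ball x₀ ρ, F z :=
    fun k => setLIntegral_prod_ball_rotZ_eq_of_ae hF I _ x₀ ρ
  simp only [hterm, Finset.sum_const, Finset.card_univ, Fintype.card_fin, nsmul_eq_mul] at hsum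
  -- division by `N ≥ ρ₀ / ρ`
  have hNtop : (N : ℝ≥0∞) ≠ ∞ := ENNReal.natCast_ne_top N
  have hN0' : (N : ℝ≥0∞) ≠ 0 := by exact_mod_cast hN0
  have hinv : (N : ℝ≥0∞)⁻¹ ≤ ENNReal.ofReal (ρ / cylRadius x₀) := by
    rw [← ENNReal.ofReal_natCast, ← ENNReal.ofReal_inv_of_pos hNpos]
    refine ENNReal.ofReal_le_ofReal ?_
    rw [inv_le_comm₀ hNpos (by positivity), inv_div]
    exact hN1
  calc ∫⁻ z in I ×ˢ ball x₀ ρ, F z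
      = (N : ℝ≥0∞)⁻¹ * ((N : ℝ≥0∞) * ∫⁻ z in I ×ˢ ball x₀ ρ, F z) := by
        rw [← mul_assoc, ENNReal.inv_mul_cancel hN0' hNtop, one_mul]
    _ ≤ (N : ℝ≥0∞)⁻¹ * ∫⁻ z in I ×ˢ (univ : Set (EuclideanSpace ℝ (Fin 3))), F z := by gcongr
    _ ≤ ENNReal.ofReal (ρ / cylRadius x₀) * ∫⁻ z in I ×ˢ (univ : Set (EuclideanSpace ℝ (Fin 3))), F z := by gcongr

end Packing

/-! ### The off-axis points of the solutions of Theorem 2.1 are regular -/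

namespace Seregin2020

open SereginSverak2009

/-- Rotations preserve the unit cylinder `Q = 𝒞 × ]-1, 0[`. [folklore] -/
theorem mem_parCyl_zero_one_rotZ_iff (θ : ℝ) (z : ℝ × EuclideanSpace ℝ (Fin 3)) :
    ((z.1, rotZ θ z.2) : ℝ × EuclideanSpace ℝ (Fin 3)) ∈ parCyl 0 1 ↔ z ∈ parCyl 0 1 := by
  simp only [mem_parCyl_zero, cylRadius_rotZ, rotZ_apply_two]

/-- **The dissipation density of an axisymmetric solution is rotation invariant a.e.** For the
density `F = 𝟙_Q |∇u|²` of a field `u` with axisymmetric slices and weak spatial gradient `G` on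
`Q = 𝒞 × ]-1, 0[`: `F(t, R_θ x) = F(t, x)` for a.e. `(t, x)`. [folklore] -/
theorem dissipation_rot_invariant_ae
    {u : ℝ → EuclideanSpace ℝ (Fin 3) → EuclideanSpace ℝ (Fin 3)}
    {G : ℝ → EuclideanSpace ℝ (Fin 3) → EuclideanSpace ℝ (Fin 3) →L[ℝ] EuclideanSpace ℝ (Fin 3)}
    (hG : HasWeakSpatialGradientOn (parCylOpens 0 1) u G)
    (hu_ax : ∀ t ∈ Ioo (-1 : ℝ) 0, IsAxisymmetric (u t)) (θ : ℝ) :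
    (fun z : ℝ × EuclideanSpace ℝ (Fin 3) =>
        (parCyl 0 1).indicator
          (fun w : ℝ × EuclideanSpace ℝ (Fin 3) => ENNReal.ofReal (frobeniusNormSq (G w.1 w.2)))
          (z.1, rotZ θ z.2)) =ᵐ[volume]
      (parCyl 0 1).indicator
        (fun w : ℝ × EuclideanSpace ℝ (Fin 3) => ENNReal.ofReal (frobeniusNormSq (G w.1 w.2))) := by
  set R : EuclideanSpace ℝ (Fin 3) ≃ₗᵢ[ℝ] EuclideanSpace ℝ (Fin 3) := rotZLIE (-θ) with hR
  have hRsymm : ∀ x, R.symm x = rotZ θ x := fun x => by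
    rw [hR, rotZLIE_symm_apply, neg_neg]
  have hRapp : ∀ x, R x = rotZ (-θ) x := fun x => rfl
  have hQ : ∀ z : ℝ × EuclideanSpace ℝ (Fin 3),
      ((z.1, R z.2) : ℝ × EuclideanSpace ℝ (Fin 3)) ∈ parCylOpens 0 1 → z ∈ parCylOpens 0 1 := by
    intro z hz
    have hz' : ((z.1, rotZ (-θ) z.2) : ℝ × EuclideanSpace ℝ (Fin 3)) ∈ parCyl 0 1 := hz
    exact (mem_parCyl_zero_one_rotZ_iff (-θ) z).1 hz'
  have hQ' : ∀ z : ℝ × EuclideanSpace ℝ (Fin 3),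
      ((z.1, R.symm z.2) : ℝ × EuclideanSpace ℝ (Fin 3)) ∈ parCylOpens 0 1 → z ∈ parCylOpens 0 1 := by
    intro z hz
    rw [hRsymm] at hz
    have hz' : ((z.1, rotZ θ z.2) : ℝ × EuclideanSpace ℝ (Fin 3)) ∈ parCyl 0 1 := hz
    exact (mem_parCyl_zero_one_rotZ_iff θ z).1 hz'
  have hu : ∀ z : ℝ × EuclideanSpace ℝ (Fin 3), z ∈ parCylOpens 0 1 →
      u z.1 (R z.2) = R (u z.1 z.2) := by
    intro z hz
    have hz' : z ∈ parCyl 0 1 := hz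
    rw [mem_parCyl_zero] at hz'
    have ht : z.1 ∈ Ioo (-1 : ℝ) 0 := by simpa using hz'.1
    rw [hRapp, hRapp]
    exact hu_ax z.1 ht (-θ) z.2
  have hae := hG.frobeniusNormSq_comp_ae_eq R hQ hQ' hu
  rw [coe_parCylOpens] at hae
  rw [Filter.EventuallyEq, ae_iff]
  rw [ae_restrict_iff' (isOpen_parCyl 0 1).measurableSet] at hae
  refine measure_mono_null (fun z hz => ?_) (ae_iff.1 hae)
  intro himp
  apply hz
  by_cases hmem : z ∈ parCyl 0 1
  · have h1 : ((z.1, rotZ θ z.2) : ℝ × EuclideanSpace ℝ (Fin 3)) ∈ parCyl 0 1 :=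
      (mem_parCyl_zero_one_rotZ_iff θ z).2 hmem
    rw [indicator_of_mem h1, indicator_of_mem hmem]
    have h2 := himp hmem
    rw [hRsymm] at h2
    show ENNReal.ofReal (frobeniusNormSq (G z.1 (rotZ θ z.2))) = ENNReal.ofReal (frobeniusNormSq (G z.1 z.2))
    rw [h2]
  · have h1 : ((z.1, rotZ θ z.2) : ℝ × EuclideanSpace ℝ (Fin 3)) ∉ parCyl 0 1 :=
      fun h => hmem ((mem_parCyl_zero_one_rotZ_iff θ z).1 h)
    rw [indicator_of_notMem h1, indicator_of_notMem hmem]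

/-- The volume of the unit cylinder `𝒞` is finite. [folklore] -/
theorem volume_spaceCyl_zero_one_lt_top : volume (spaceCyl (0 : EuclideanSpace ℝ (Fin 3)) 1) < ∞ :=
  (measure_mono (spaceCyl_subset_ball 0 zero_le_one)).trans_lt measure_ball_lt_top

/-- **Vanishing dissipation tails**: if `∫∫_Q |∇u|² < ∞` then for every `δ > 0` there is `τ > 0`
with `∫_{]t₁ - τ, t₁[ × EuclideanSpace ℝ (Fin 3)} 𝟙_Q |∇u|² < δ`. [folklore] -/
theorem exists_tail_lt
    {G : ℝ → EuclideanSpace ℝ (Fin 3) → EuclideanSpace ℝ (Fin 3) →L[ℝ] EuclideanSpace ℝ (Fin 3)}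
    (hE : ∫⁻ z in parCyl 0 1, ENNReal.ofReal (frobeniusNormSq (G z.1 z.2)) < ∞) (t₁ : ℝ)
    {δ : ℝ≥0∞} (hδ : 0 < δ) :
    ∃ τ : ℝ, 0 < τ ∧ ∫⁻ z in Ioo (t₁ - τ) t₁ ×ˢ (univ : Set (EuclideanSpace ℝ (Fin 3))),
      (parCyl 0 1).indicator
        (fun w : ℝ × EuclideanSpace ℝ (Fin 3) => ENNReal.ofReal (frobeniusNormSq (G w.1 w.2))) z < δ := by
  set f : ℝ × EuclideanSpace ℝ (Fin 3) → ℝ≥0∞ :=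
    fun w => ENNReal.ofReal (frobeniusNormSq (G w.1 w.2)) with hf
  set F : ℝ × EuclideanSpace ℝ (Fin 3) → ℝ≥0∞ := (parCyl 0 1).indicator f with hF
  have hmeas : MeasurableSet (parCyl (0 : ℝ × EuclideanSpace ℝ (Fin 3)) 1) :=
    (isOpen_parCyl 0 1).measurableSet
  -- `∫ F < ∞`
  have hFint : ∫⁻ z, F z ≠ ∞ := by
    rw [hF, lintegral_indicator hmeas]
    exact hE.ne
  -- the integral over `I × EuclideanSpace ℝ (Fin 3)` is the integral over `I × 𝒞`
  have hred : ∀ τ : ℝ, ∫⁻ z in Ioo (t₁ - τ) t₁ ×ˢ (univ : Set (EuclideanSpace ℝ (Fin 3))), F z =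
      ∫⁻ z in Ioo (t₁ - τ) t₁ ×ˢ spaceCyl (0 : EuclideanSpace ℝ (Fin 3)) 1, F z := by
    intro τ
    have hset : parCyl (0 : ℝ × EuclideanSpace ℝ (Fin 3)) 1 ∩
        (Ioo (t₁ - τ) t₁ ×ˢ (univ : Set (EuclideanSpace ℝ (Fin 3)))) =
        parCyl (0 : ℝ × EuclideanSpace ℝ (Fin 3)) 1 ∩
          (Ioo (t₁ - τ) t₁ ×ˢ spaceCyl (0 : EuclideanSpace ℝ (Fin 3)) 1) := by
      ext z
      simp only [mem_inter_iff, mem_prod, mem_univ, and_true]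
      constructor
      · rintro ⟨h1, h2⟩
        exact ⟨h1, h2, h1.2⟩
      · rintro ⟨h1, h2, -⟩
        exact ⟨h1, h2⟩
    rw [hF, lintegral_indicator hmeas, lintegral_indicator hmeas, Measure.restrict_restrict hmeas,
      Measure.restrict_restrict hmeas, hset]
  -- the measures of `I × 𝒞` tend to zero
  have hvol : Tendsto (fun τ : ℝ => volume (Ioo (t₁ - τ) t₁ ×ˢ spaceCyl (0 : EuclideanSpace ℝ (Fin 3)) 1))
      (𝓝[>] 0) (𝓝 0) := by
    have e : ∀ τ : ℝ, 0 < τ → volume (Ioo (t₁ - τ) t₁ ×ˢ spaceCyl (0 : EuclideanSpace ℝ (Fin 3)) 1) =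
        ENNReal.ofReal τ * volume (spaceCyl (0 : EuclideanSpace ℝ (Fin 3)) 1) := by
      intro τ hτ
      rw [Measure.volume_eq_prod, Measure.prod_prod, Real.volume_Ioo]
      congr 1
      congr 1
      ring
    have h0 : Tendsto (fun τ : ℝ => ENNReal.ofReal τ * volume (spaceCyl (0 : EuclideanSpace ℝ (Fin 3)) 1))
        (𝓝[>] 0) (𝓝 0) := by
      have h1 : Tendsto (fun τ : ℝ => ENNReal.ofReal τ) (𝓝[>] (0 : ℝ)) (𝓝 0) := by
        have := (ENNReal.continuous_ofReal.tendsto 0).mono_left (nhdsWithin_le_nhds (s := Ioi (0 : ℝ)))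
        rwa [ENNReal.ofReal_zero] at this
      have h2 := ENNReal.Tendsto.mul_const h1 (Or.inr volume_spaceCyl_zero_one_lt_top.ne)
      rwa [zero_mul] at h2
    refine h0.congr' ?_
    filter_upwards [self_mem_nhdsWithin] with τ hτ
    exact (e τ hτ).symm
  have hlim := tendsto_setLIntegral_zero (μ := volume) hFint hvol
  have hev : ∀ᶠ τ in 𝓝[>] (0 : ℝ), ∫⁻ z in Ioo (t₁ - τ) t₁ ×ˢ spaceCyl (0 : EuclideanSpace ℝ (Fin 3)) 1, F z < δ :=
    (tendsto_order.1 hlim).2 δ hδ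
  obtain ⟨τ, hτ, hτpos⟩ := (hev.and self_mem_nhdsWithin).exists
  refine ⟨τ, hτpos, ?_⟩
  rw [hred]
  exact hτ

/-- **Seregin 2020, proof of Thm. 2.1: "`x' = 0` for any `z = (x, t) ∈ S`"** — every point of
`𝒞 × ]-1, 0]` off the axis is a regular point of an axisymmetric suitable weak solution of the
class of Theorem 2.1 (backward cylinders: `v ∈ L_∞(Q(z₁, r))` for some `r > 0`). Proof: module
docstring. [cite: Seregin2020, proof of Thm. 2.1 (structure of the singular set, arXiv p. 5)] -/
theorem offAxis_regular
    {u : ℝ → EuclideanSpace ℝ (Fin 3) → EuclideanSpace ℝ (Fin 3)}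
    {p : ℝ → EuclideanSpace ℝ (Fin 3) → ℝ}
    {G : ℝ → EuclideanSpace ℝ (Fin 3) → EuclideanSpace ℝ (Fin 3) →L[ℝ] EuclideanSpace ℝ (Fin 3)}
    (hsw : IsSuitableWeakSolutionOn (parCylOpens 0 1) 1 0 u p)
    (hA : ∃ C : ℝ≥0, ∀ᵐ t ∂(volume.restrict (Ioo (-1 : ℝ) 0)),
      ∫⁻ x in spaceCyl 0 1, ‖u t x‖ₑ ^ 2 ≤ C)
    (hG : HasWeakSpatialGradientOn (parCylOpens 0 1) u G)
    (hE : ∫⁻ z in parCyl 0 1, ENNReal.ofReal (frobeniusNormSq (G z.1 z.2)) < ∞)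
    (hp : ∫⁻ z in parCyl 0 1, ‖p z.1 z.2‖ₑ ^ (3 / 2 : ℝ) < ∞)
    (hu_ax : ∀ t ∈ Ioo (-1 : ℝ) 0, IsAxisymmetric (u t))
    {z₁ : ℝ × EuclideanSpace ℝ (Fin 3)} (ht₁ : z₁.1 ∈ Ioc (-1 : ℝ) 0)
    (hx₁ : z₁.2 ∈ spaceCyl (0 : EuclideanSpace ℝ (Fin 3)) 1) (hoff : 0 < cylRadius z₁.2) :
    ∃ r : ℝ, 0 < r ∧ eLpNorm (uncurry u) ∞ (volume.restrict (parabolicCylinder r z₁)) < ∞ := by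
  obtain ⟨ε, hε, Hreg⟩ := seregin2014_thm14_holds
  set ρ₁ : ℝ := cylRadius z₁.2 with hρ₁
  set F : ℝ × EuclideanSpace ℝ (Fin 3) → ℝ≥0∞ := (parCyl 0 1).indicator
    (fun w : ℝ × EuclideanSpace ℝ (Fin 3) => ENNReal.ofReal (frobeniusNormSq (G w.1 w.2))) with hF
  have hFrot : ∀ θ : ℝ, (fun z : ℝ × EuclideanSpace ℝ (Fin 3) => F (z.1, rotZ θ z.2)) =ᵐ[volume] F :=
    fun θ => dissipation_rot_invariant_ae hG hu_ax θ
  -- ### geometry: a radius `R₀` with `Q(z₁, R₀) ⊆ Q`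
  obtain ⟨r₀, hr₀, hball⟩ := Metric.isOpen_iff.1 (isOpen_spaceCyl 0 1) z₁.2 hx₁
  set R₀ : ℝ := min (min ρ₁ r₀) (min 1 ((z₁.1 + 1) / 2)) with hR₀
  have ht1 : -1 < z₁.1 := ht₁.1
  have ht0 : z₁.1 ≤ 0 := ht₁.2
  have hR₀pos : 0 < R₀ := lt_min (lt_min hoff hr₀) (lt_min one_pos (by linarith))
  have hR₀ρ : R₀ ≤ ρ₁ := (min_le_left _ _).trans (min_le_left _ _)
  have hR₀r : R₀ ≤ r₀ := (min_le_left _ _).trans (min_le_right _ _)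
  have hR₀1 : R₀ ≤ 1 := (min_le_right _ _).trans (min_le_left _ _)
  have hR₀t : R₀ ≤ (z₁.1 + 1) / 2 := (min_le_right _ _).trans (min_le_right _ _)
  have hsubQ : ∀ R : ℝ, 0 < R → R ≤ R₀ → parabolicCylinder R z₁ ⊆ parCyl 0 1 := by
    intro R hR hRR₀ w hw
    rw [mem_parabolicCylinder] at hw
    obtain ⟨⟨hw1, hw2⟩, hw3⟩ := hw
    have hR2 : R ^ 2 ≤ R₀ := by nlinarith
    refine ⟨⟨?_, by simpa using (lt_of_lt_of_le hw2 ht0)⟩, hball (lt_of_lt_of_le hw3 (hRR₀.trans hR₀r))⟩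
    simp only [Prod.fst_zero]
    nlinarith
  -- ### the tail
  have hδ : (0 : ℝ≥0∞) < ENNReal.ofReal (ε * ρ₁ / 2) := ENNReal.ofReal_pos.2 (by positivity)
  obtain ⟨τ, hτ, htail⟩ := exists_tail_lt hE z₁.1 hδ
  -- ### the radius of the rescaling
  set R : ℝ := min R₀ τ with hRdef
  have hR : 0 < R := lt_min hR₀pos hτ
  have hRR₀ : R ≤ R₀ := min_le_left _ _
  have hRτ : R ≤ τ := min_le_right _ _
  have hR1 : R ≤ 1 := hRR₀.trans hR₀1
  have hRρ : R ≤ ρ₁ := hRR₀.trans hR₀ρ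
  have hR2 : 0 < R ^ 2 := by positivity
  have hQR : parabolicCylinder R z₁ ⊆ parCyl 0 1 := hsubQ R hR hRR₀
  have hleR : parabolicCylinderOpens R z₁ ≤ parCylOpens 0 1 := fun w hw => hQR hw
  -- ### the pair in Albritton–Barker's class on `Q(z₁, R)`
  have hIsub : Ioo (z₁.1 - R ^ 2) z₁.1 ⊆ Ioo (-1 : ℝ) 0 := by
    intro t ht
    have hR2' : R ^ 2 ≤ R₀ := by nlinarith
    exact ⟨by linarith [ht.1], lt_of_lt_of_le ht.2 ht0⟩
  have hBsub : ball z₁.2 R ⊆ spaceCyl (0 : EuclideanSpace ℝ (Fin 3)) 1 := fun x hx =>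
    hball (lt_of_lt_of_le (mem_ball.1 hx) (hRR₀.trans hR₀r))
  have hballR : IsSuitableWeakSolutionInBall R z₁ u p := by
    refine ⟨hsw.of_le hleR, ?_, ⟨G, hG.mono hleR, (lintegral_mono_set hQR).trans_lt hE⟩, ?_⟩
    · obtain ⟨C, hC⟩ := hA
      refine ⟨C, ?_⟩
      filter_upwards [ae_restrict_of_ae_restrict_of_subset hIsub hC] with t ht
      exact (lintegral_mono_set hBsub).trans ht
    · have hpm : AEStronglyMeasurable (uncurry p) (volume.restrict (parabolicCylinder R z₁)) :=
        hsw.distributional.2.2.1.aestronglyMeasurable.mono_measure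
          (Measure.restrict_mono (hQR.trans (subset_of_eq (coe_parCylOpens 0 1).symm)) le_rfl)
      have hfin : ∫⁻ z in parabolicCylinder R z₁, ‖uncurry p z‖ₑ ^ (3 / 2 : ℝ) ≠ ∞ :=
        ((lintegral_mono_set hQR).trans_lt hp).ne
      exact (memLp_threeHalves_of_lintegral_le hpm hfin le_rfl).1
  -- ### the rescaled pair on `Q(0, 1)` and its gradient
  have hball1 := hballR.zoom hR
  set G₁ : ℝ → EuclideanSpace ℝ (Fin 3) → EuclideanSpace ℝ (Fin 3) →L[ℝ] EuclideanSpace ℝ (Fin 3) :=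
    (R ^ 2) • stPull (R ^ 2) R z₁.1 z₁.2 G with hG₁
  have hG₁w : HasWeakSpatialGradientOn (parabolicCylinderOpens 1 (0 : ℝ × EuclideanSpace ℝ (Fin 3)))
      (R • stPull (R ^ 2) R z₁.1 z₁.2 u) G₁ := by
    have h1 := (hG.mono hleR).stRescale R hR2 hR z₁.1 z₁.2
    rw [zoom_stPreimage_parabolicCylinderOpens hR z₁, ← pow_two] at h1
    exact h1
  have hz₁ : stAffine (R ^ 2) R z₁.1 z₁.2 (0 : ℝ × EuclideanSpace ℝ (Fin 3)) = z₁ :=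
    Prod.ext (by simp [stAffine]) (by simp [stAffine])
  -- ### the dissipation of the rescaled pair is small at all scales
  have hEsmall : ∀ r ∈ Ioo (0 : ℝ) 1, cknE r (0 : ℝ × EuclideanSpace ℝ (Fin 3)) G₁ ≤
      ENNReal.ofReal (ε / 2) := by
    intro r hr
    have hRr : 0 < R * r := mul_pos hR hr.1
    have hRr1 : R * r ≤ R := mul_le_of_le_one_right hR.le hr.2.le
    rw [hG₁, cknE_nsZoom hR hr.1 z₁.1 z₁.2 0 G, hz₁, cknE]
    -- `∫_{Q(z₁, Rr)} |∇u|² = ∫_{I × B} F`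
    have hsub1 : parabolicCylinder (R * r) z₁ ⊆ parCyl 0 1 :=
      (parabolicCylinder_mono hRr.le hRr1 z₁).trans hQR
    have e1 : ∫⁻ q in parabolicCylinder (R * r) z₁, ENNReal.ofReal (frobeniusNormSq (G q.1 q.2)) =
        ∫⁻ q in Ioo (z₁.1 - (R * r) ^ 2) z₁.1 ×ˢ ball z₁.2 (R * r), F q := by
      rw [show parabolicCylinder (R * r) z₁ = Ioo (z₁.1 - (R * r) ^ 2) z₁.1 ×ˢ ball z₁.2 (R * r) from rfl]
      refine setLIntegral_congr_fun (measurableSet_Ioo.prod measurableSet_ball) fun q hq => ?_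
      rw [hF, indicator_of_mem (hsub1 hq)]
    rw [e1]
    -- packing
    have hpack := setLIntegral_prod_ball_le_of_rot_invariant hFrot hoff hRr (hRr1.trans hRρ)
      (measurableSet_Ioo (a := z₁.1 - (R * r) ^ 2) (b := z₁.1))
    -- the tail at `(Rr)² ≤ τ`
    have hI2 : Ioo (z₁.1 - (R * r) ^ 2) z₁.1 ⊆ Ioo (z₁.1 - τ) z₁.1 := by
      refine Ioo_subset_Ioo ?_ le_rfl
      have : (R * r) ^ 2 ≤ τ := by nlinarith [hr.1, hr.2]
      linarith
    have htail' : ∫⁻ q in Ioo (z₁.1 - (R * r) ^ 2) z₁.1 ×ˢ (univ : Set (EuclideanSpace ℝ (Fin 3))), F q ≤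
        ENNReal.ofReal (ε * ρ₁ / 2) :=
      (lintegral_mono_set (prod_mono_left hI2)).trans htail.le
    calc (ENNReal.ofReal (R * r))⁻¹ * ∫⁻ q in Ioo (z₁.1 - (R * r) ^ 2) z₁.1 ×ˢ ball z₁.2 (R * r), F q
        ≤ (ENNReal.ofReal (R * r))⁻¹ * (ENNReal.ofReal (R * r / ρ₁) * ENNReal.ofReal (ε * ρ₁ / 2)) := by
          gcongr
          exact hpack.trans (by gcongr)
      _ = ENNReal.ofReal (ε / 2) := by
          rw [div_eq_mul_inv (R * r), ENNReal.ofReal_mul hRr.le, ← mul_assoc, ← mul_assoc,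
            ENNReal.inv_mul_cancel (ENNReal.ofReal_pos.2 hRr).ne' ENNReal.ofReal_ne_top, one_mul,
            ← ENNReal.ofReal_mul (inv_nonneg.2 hoff.le)]
          congr 1
          field_simp
  have hsup : (⨆ r ∈ Ioo (0 : ℝ) 1, cknE r (0 : ℝ × EuclideanSpace ℝ (Fin 3)) G₁) < ENNReal.ofReal ε := by
    refine lt_of_le_of_lt (iSup₂_le fun r hr => hEsmall r hr) ?_
    exact (ENNReal.ofReal_lt_ofReal_iff hε).2 (by linarith)
  -- ### Seregin's criterion and transport back
  obtain ⟨ϱ, hϱ, hbdd⟩ := Hreg _ _ hball1 ⟨G₁, hG₁w, hsup⟩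
  refine ⟨R * ϱ, mul_pos hR hϱ.1, ?_⟩
  have e := eLpNorm_top_nsZoom hR z₁.1 z₁.2 ϱ (0 : ℝ × EuclideanSpace ℝ (Fin 3)) u
  rw [hz₁] at e
  rw [e] at hbdd
  have hR0 : ENNReal.ofReal R ≠ 0 := (ENNReal.ofReal_pos.2 hR).ne'
  exact lt_of_le_of_lt (by
    calc eLpNorm (uncurry u) ∞ (volume.restrict (parabolicCylinder (R * ϱ) z₁))
        = (ENNReal.ofReal R)⁻¹ * (ENNReal.ofReal R *
            eLpNorm (uncurry u) ∞ (volume.restrict (parabolicCylinder (R * ϱ) z₁))) := by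
          rw [← mul_assoc, ENNReal.inv_mul_cancel hR0 ENNReal.ofReal_ne_top, one_mul]
      _ ≤ _ := le_rfl)
    (ENNReal.mul_lt_top (ENNReal.inv_lt_top.2 (ENNReal.ofReal_pos.2 hR)) hbdd)

end Seregin2020

end Literature.Analysis.FluidPDE

end
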